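import Mathlib
import Literature.NumberTheory.Congruences.ZolotarevLemmaJacobi
import Literature.GroupTheory.TopologicallyCyclicIndex
import HarnessLib

/-!
# The Cayley signature `ϵ_G(g) = (−1)^{(a−1)N/a}` of a translation of a finite group, Euler's criterion for it,
# Morton's criterion (`ϵ_G` is nontrivial iff the Sylow `2`-subgroups are cyclic and nontrivial), its kernel: the
# unique subgroup of index `2`, and its behaviour under quotients `G → G/H`
# (Brunyate–Clark, *Extending the Zolotarev–Frobenius approach to quadratic reciprocity*, §1.1, Theorem 1.4 (a)–(d) and
# Lemma 1.6)

Layer `Literature/GroupTheory`, namespace `Literature.GroupTheory`; lane `lit-hodgefound` (Track 2 foundations library), prover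
seat `lit-hodgefound-p06`, generation 49, self-proposed rows g49-#5 ((a)–(c)), g49-#6 (append: (d)) and g49-#8 (append:
§2.2 Lemma 2.2, the additive form); generation 50, row g50-#3 (append: §1.6, Lemma 1.6). Theorems only,
all **proved**: no definition, no instance, no notation, no named fact. Uses `NumberTheory/Congruences/ZolotarevLemmaJacobi.lean`
(g49-#1: translation by a generator `g ≠ 1` of a finite cyclic group is a `|G|`-cycle, `sign_toPerm_self_of_generator`),
`GroupTheory/TopologicallyCyclicIndex.lean` (`Subgroup.eq_of_index_eq_of_isCyclic_quotient'`: over a normal subgroup with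
cyclic quotient an intermediate subgroup is determined by its index) and, for Cayley's normal `2`-complement theorem invoked
in the printed proof of (d) ("[Cr11, Cor. 1.14]"), Mathlib's Burnside-transfer form `IsCyclic.isComplement'` (a cyclic Sylow
subgroup for the least prime divisor of `|G|` has a normal complement).

## Source, verbatim ([BrunyateClark2014] §1.1, held `paper:doi-10-1007-s11139-014-9635-y` p. 6)

"Let `G` be a finite group acting on itself on the left: `ρ_G : G → Sym G`, `g ↦ g•`. The associated Cayley signature `ϵ_G`
is easily understood. **Theorem 1.4.** Let `G` be a finite group and let `g ∈ G`. Put `N = #G` and `a = #⟨g⟩`.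
a) If `g ∈ G` has order `a`, then `ρ_G(g)` is a union of `N/a` `a`-cycles.
b) The following are equivalent: (i) `ϵ_G(g) ≠ 1`. (ii) `a` is even and `N/a` is odd. (iii) (Euler Criterion)
`g^{N/2} ≠ 1`.
c) (Morton [Mo79]) The following are equivalent: (i) The signature map `ϵ_G` is nontrivial. (ii) The 2-Sylow subgroups
of `G` are cyclic and nontrivial.
d) If `ϵ_G` is nontrivial, its kernel `K` is the unique index 2 subgroup of `G`.
Proof. a) The cycles of `ϵ_G(g)` are the right cosets of `⟨g⟩` in `G`. b) By a), `ϵ_G(g) = (−1)^{(a−1)N/a}`, so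
(i) ⟺ (ii). If `a` is odd, then `g^{N/2}` has odd order and order dividing `2`, so `g^{N/2} = 1`. Now assume that `a`,
and hence `N`, is even. Then the order of `g^{N/2}` = `a / gcd(a, N/2)`. Thus `g^{N/2} = 1` iff `gcd(a, N/2) = a` iff
`a | N/2` iff `N/a` is even. c) By part a), `ϵ_G` is nontrivial iff there is `g ∈ G` such that `⟨g⟩` has even order and
odd index. If so, `⟨g⟩` is a cyclic, nontrivial 2-Sylow subgroup. Conversely, a generator `g` of a nontrivial cyclic
2-Sylow subgroup has even order and odd index.
d) If `ϵ_G` is nontrivial, then `K = Ker ϵ` is an index 2 subgroup of `G`, so it's enough to show that `G` has exactly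
one index 2 subgroup. By part b) `G` has a cyclic 2-Sylow subgroup `P`. It is a theorem of Cayley (!) that there is a
normal subgroup `N` of `G` such that `G = N ⋊ P`: see e.g. [Cr11, Cor. 1.14]. […] If `H` is an index 2 subgroup, it
is normal and `G/H` is a 2-group, so `H ⊃ N`. Since `G/N ≅ P` is even order cy[c]lic, there is precisely one index 2
subgroup of `G` containing `N`." (p. 6–7)
"**Lemma 1.6.** Let `H` be a normal subgroup of `G`; put `G′ = G/H` and `q : G → G′`. a) If `ϵ_G` and `ϵ_{G′}` are both
trivial or both nontrivial, then (4) `ϵ_G = ϵ_{G′} ∘ q`. b) If `H` has odd order, then (4) holds. Proof. a) Certainly (4)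
holds if `ϵ_G` and `ϵ_{G′}` are both trivial, so suppose both are nontrivial. Then `Ker ϵ_{G′} ∘ q` is an index 2 subgroup
of `G`. By Theorem 1.4c), if `ϵ_G` is nontrivial there is a unique index 2 subgroup, so `Ker ϵ_{G′} ∘ q = Ker ϵ_G`, and two
homomorphisms into `{±1}` are equal iff their kernels are equal. b) Let `P` be a Sylow 2-subgroup of `G`. Then `PH/H` is a
2-Sylow subgroup of `G′`. Since `#H` is odd and `P` is a 2-group, `PH/H ≅ P/(P ∩ H) = P`. Thus by Theorem 1.4b), `ϵ_G` is
nontrivial iff `ϵ_{G′}` is nontrivial, so part a) applies." (p. 7)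

## What is typed

`ρ_G(g)` is Mathlib's `MulAction.toPerm g : Perm G` (`x ↦ g x`); the right translation `x ↦ x g` is `Equiv.mulRight g`; the
two have the same signature (`sign_toPerm_eq_sign_mulRight`: `x ↦ x⁻¹` conjugates one to the inverse of the other).
* (a) `sameCycle_toPerm_iff` — "the cycles of `ρ_G(g)` are the right cosets of `⟨g⟩`": `x, y` lie in one cycle of `ρ_G(g)`
  iff `y x⁻¹ ∈ ⟨g⟩`; `exists_equiv_quotient_prod` — `G ≃ (G/H) × H` by coset representatives, along which (for `H = ⟨g⟩`)
  the right translation by `g` is `N/a` copies of the `a`-cycle "translation by `g` on `⟨g⟩`" (`sign_mulRight_zpowers`).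
* (b) **`sign_mulRight_eq`**, **`sign_toPerm_self_eq`** — `ϵ_G(g) = (−1)^{(a−1)·N/a}` (read in `ℤ`);
  `sign_toPerm_self_ne_one_iff` — (i) ⟺ (ii); `sign_toPerm_self_ne_one_iff_pow_ne_one` — (i) ⟺ (iii), typed for `N` even:
  for odd `N` every `a` is odd and `ϵ_G` is trivial (tree: `Congruences/ZolotarevReciprocity.lean`,
  `sign_toPerm_self_eq_one_of_odd_card`), while `g^{⌊N/2⌋} ≠ 1` may hold (`G = ℤ/3`), so the printed (i) ⟺ (iii) is the
  even-`N` statement (the source: "assume that `a`, and hence `N`, is even").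
* (c) **`exists_sign_toPerm_ne_one_iff`** — Morton's criterion: some `ϵ_G(g) ≠ 1` iff every Sylow `2`-subgroup of `G` is
  cyclic and nontrivial.
* (d) **`eq_ker_sign_comp_toPermHom_of_index_eq_two`**, `existsUnique_index_eq_two` — if `ϵ_G = sign ∘ ρ_G` is
  nontrivial, its kernel (`index_ker_sign_comp_toPermHom`: of index `2`) is the unique subgroup of index `2`; the printed
  proof: elements of odd order lie in every index-`2` subgroup (`mem_of_index_eq_two_of_odd_orderOf`), so the normal
  `2`-complement `N` does, and `G/N ≅ P` is cyclic.
* §2.2 **Lemma 2.2 (a)** ([BrunyateClark2014] p. 10: "Let `r` be a finite ring. Then both the additive group `(r, +)` and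
  the unit group `(r^×, ·)` act on `r` […] `s_a : x ↦ x + a` […] The former is a special case of Theorem 1.4: we record the
  result. **Lemma 2.2.** Let `n` be the order of `a` in `(r, +)`. a) `ϵ(s_a) = (−1)^{(n−1)#r/n}`. b) Since `n | #r`,
  `ϵ(s_a) = 1` if `#r` is odd.") — `sign_addRight_eq`, `sign_addLeft_toPerm_eq`: Theorem 1.4 (b) transported to an additive
  group (`Multiplicative`); (b) is the tree's `Congruences/ZolotarevReciprocity.sign_addRight_eq_one_of_odd_card`.
* §1.6 **Lemma 1.6**: `sign_toPerm_eq_sign_toPerm_quotient` ((a): if `ϵ_G`, `ϵ_{G/H}` are both trivial or both nontrivial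
  then `ϵ_G(g) = ϵ_{G/H}(gH)`), **`sign_toPerm_eq_sign_toPerm_quotient_of_odd_card`** ((b): always so when `#H` is odd), with
  the printed Sylow transport `bijective_subgroupMap_mk_sylow_of_odd_card` (`q|_P : P ≅ PH/H`, Mathlib's `Sylow.mapSurjective`)
  and `forall_sylow_isCyclic_and_ne_bot_iff_quotient`.

## References

* [BrunyateClark2014] A. Brunyate, P. L. Clark, *Extending the Zolotarev–Frobenius approach to quadratic reciprocity*,
  Ramanujan J. 37 (2015) 25–50, §1.1 Theorem 1.4, Lemma 1.6.
* P. Morton, *A generalization of Zolotarev's theorem*, Amer. Math. Monthly 86 (1979) 374–375 (Theorem 1.4 (c), as cited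
  in [BrunyateClark2014]).
* D. A. Craven, *The theory of fusion systems*, CUP 2011, Cor. 1.14 (Cayley's normal `2`-complement theorem, as cited in
  [BrunyateClark2014] for Theorem 1.4 (d)).
-/

open Equiv Equiv.Perm Subgroup Literature.NumberTheory.Congruences.Zolotarev

namespace Literature.GroupTheory

variable {G : Type*} [Group G]

/-! ### (a) The cycles of `ρ_G(g)` are the right cosets of `⟨g⟩` -/

/-- **Theorem 1.4 (a), proof**: "The cycles of `ρ_G(g)` are the right cosets of `⟨g⟩` in `G`" — `x` and `y` lie in the
same cycle of `ρ_G(g) : z ↦ g z` iff `y x⁻¹ ∈ ⟨g⟩`. [cite: BrunyateClark2014, §1.1 Thm. 1.4 (a)] -/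
theorem sameCycle_toPerm_iff (g x y : G) :
    (MulAction.toPerm g : Perm G).SameCycle x y ↔ y * x⁻¹ ∈ zpowers g := by
  constructor
  · rintro ⟨i, hi⟩
    refine mem_zpowers_iff.mpr ⟨i, ?_⟩
    change ((MulAction.toPermHom G G g) ^ i) x = y at hi
    rw [← map_zpow, MulAction.toPermHom_apply, MulAction.toPerm_apply, smul_eq_mul] at hi
    rw [← hi, mul_inv_cancel_right]
  · intro h
    obtain ⟨i, hi⟩ := mem_zpowers_iff.mp h
    refine ⟨i, ?_⟩
    change ((MulAction.toPermHom G G g) ^ i) x = y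
    rw [← map_zpow, MulAction.toPermHom_apply, MulAction.toPerm_apply, smul_eq_mul, hi, inv_mul_cancel_right]

/-- `G ≃ (G/H) × H` by coset representatives (`(qH, h) ↦ q̄ h`, `q̄` a chosen representative of the left coset `qH`);
for `H = ⟨g⟩` the right translation `x ↦ x g` of `G` becomes `|G/H| = N/a` disjoint copies of the translation by `g` on
`⟨g⟩` — the decomposition "`ρ_G(g)` is a union of `N/a` `a`-cycles" of Theorem 1.4 (a), for the right regular action.
[cite: BrunyateClark2014, §1.1 Thm. 1.4 (a)] -/
theorem exists_equiv_quotient_prod (H : Subgroup G) :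
    ∃ e : (G ⧸ H) × H ≃ G, ∀ (q : G ⧸ H) (h : H), e (q, h) = Quotient.out q * h := by
  classical
  have hinj : Function.Injective fun p : (G ⧸ H) × H => Quotient.out p.1 * (p.2 : G) := by
    rintro ⟨q, h⟩ ⟨q', h'⟩ hqq
    dsimp only at hqq
    have hq : q = q' := by
      rw [← QuotientGroup.out_eq' q, ← QuotientGroup.out_eq' q', ← QuotientGroup.mk_mul_of_mem (Quotient.out q) h.2,
        hqq, QuotientGroup.mk_mul_of_mem _ h'.2]
    subst hq
    rw [Subtype.ext (mul_left_cancel hqq)]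
  have hsurj : Function.Surjective fun p : (G ⧸ H) × H => Quotient.out p.1 * (p.2 : G) := fun x =>
    ⟨(QuotientGroup.mk x, ⟨(Quotient.out (QuotientGroup.mk x : G ⧸ H))⁻¹ * x,
      QuotientGroup.eq.mp (QuotientGroup.out_eq' _)⟩), mul_inv_cancel_left _ _⟩
  exact ⟨Equiv.ofBijective _ ⟨hinj, hsurj⟩, fun _ _ => rfl⟩

/-! ### (b) `ϵ_G(g) = (−1)^{(a−1)N/a}` -/

/-- In the cyclic group `⟨g⟩` (of order `a`), translation by `g` is an `a`-cycle: its sign is `(−1)^{a−1}` (read in `ℤ`).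
[cite: BrunyateClark2014, §1.1 Thm. 1.4 (a)–(b)] -/
theorem sign_mulRight_zpowers [Fintype G] [DecidableEq G] (g : G) :
    ((Perm.sign (Equiv.mulRight (⟨g, mem_zpowers g⟩ : zpowers g)) : ℤˣ) : ℤ) = (-1) ^ (orderOf g - 1) := by
  by_cases hg1 : g = 1
  · subst hg1
    rw [show (⟨(1 : G), mem_zpowers (1 : G)⟩ : zpowers (1 : G)) = 1 from rfl, Equiv.mulRight_one, Perm.sign_one,
      Units.val_one, orderOf_one]
    norm_num
  · -- `⟨g⟩` is generated by `g`, and in the commutative group `⟨g⟩` right and left translation by `g` agree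
    have hgen : ∀ x : zpowers g, x ∈ zpowers (⟨g, mem_zpowers g⟩ : zpowers g) := by
      rintro ⟨x, hx⟩
      obtain ⟨k, rfl⟩ := mem_zpowers_iff.mp hx
      exact mem_zpowers_iff.mpr ⟨k, Subtype.ext (Subgroup.coe_zpow _ _ _)⟩
    have hlr : Equiv.mulRight (⟨g, mem_zpowers g⟩ : zpowers g) =
        (MulAction.toPerm (⟨g, mem_zpowers g⟩ : zpowers g) : Perm (zpowers g)) := by
      refine Equiv.ext fun x => Subtype.ext ?_
      obtain ⟨k, hk⟩ := mem_zpowers_iff.mp x.2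
      simp only [Equiv.coe_mulRight, MulAction.toPerm_apply, smul_eq_mul, Subgroup.coe_mul, ← hk]
      exact (Commute.zpow_self g k).eq
    have hpos := orderOf_pos g
    obtain ⟨a, ha⟩ : ∃ a, orderOf g = a + 1 := ⟨orderOf g - 1, by omega⟩
    rw [hlr, sign_toPerm_self_of_generator hgen fun h => hg1 (congrArg Subtype.val h), ← Nat.card_eq_fintype_card,
      Nat.card_zpowers, ha, Nat.add_sub_cancel, pow_succ]
    ring

/-- **Theorem 1.4 (b), the formula `ϵ = (−1)^{(a−1)·N/a}` for the right translation `x ↦ x g`** (`a` the order of `g`,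
`N = |G|`; read in `ℤ`): along `G ≃ (G/⟨g⟩) × ⟨g⟩` it is `N/a` disjoint `a`-cycles.
[cite: BrunyateClark2014, §1.1 Thm. 1.4 (a)–(b) ("ϵ_G(g) = (−1)^{(a−1)N/a}")] -/
theorem sign_mulRight_eq [Fintype G] [DecidableEq G] (g : G) :
    ((Perm.sign (Equiv.mulRight g) : ℤˣ) : ℤ) = (-1) ^ ((orderOf g - 1) * (Fintype.card G / orderOf g)) := by
  classical
  obtain ⟨e, he⟩ := exists_equiv_quotient_prod (zpowers g)
  have hcomm : ∀ p : (G ⧸ zpowers g) × zpowers g,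
      e ((prodCongrRight fun _ : G ⧸ zpowers g => Equiv.mulRight (⟨g, mem_zpowers g⟩ : zpowers g)) p) =
        Equiv.mulRight g (e p) := by
    rintro ⟨q, h⟩
    simp only [prodCongrRight_apply, he, Equiv.coe_mulRight, Subgroup.coe_mul, mul_assoc]
  -- `|G/⟨g⟩| · a = N`
  have hidx : (zpowers g).index * orderOf g = Fintype.card G := by
    rw [← Nat.card_zpowers, ← Nat.card_eq_fintype_card]
    exact (zpowers g).index_mul_card
  rw [← sign_eq_sign_of_equiv _ _ e hcomm, sign_prodCongrRight, Finset.prod_const, Finset.card_univ,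
    Units.val_pow_eq_pow_val, sign_mulRight_zpowers, ← pow_mul, ← Nat.card_eq_fintype_card (α := G ⧸ zpowers g),
    ← Subgroup.index_eq_card, ← hidx, Nat.mul_div_cancel _ (orderOf_pos g)]

/-- The left translation `ρ_G(g) : x ↦ g x` and the right translation `x ↦ x g` have the same signature (`x ↦ x⁻¹`
conjugates `x ↦ g x` to `x ↦ x g⁻¹`, the inverse of `x ↦ x g`). [cite: BrunyateClark2014, §1.1 Thm. 1.4 (a)–(b)] -/
theorem sign_toPerm_eq_sign_mulRight [Fintype G] [DecidableEq G] (g : G) :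
    Perm.sign (MulAction.toPerm g : Perm G) = Perm.sign (Equiv.mulRight g) := by
  rw [sign_eq_sign_of_equiv (MulAction.toPerm g : Perm G) (Equiv.mulRight g⁻¹) (Equiv.inv G) fun x => by
      simp only [Equiv.inv_apply, MulAction.toPerm_apply, smul_eq_mul, Equiv.coe_mulRight, mul_inv_rev],
    ← Equiv.mulRight_symm, Perm.sign_symm]

/-- **Theorem 1.4 (b), the Cayley signature: `ϵ_G(g) = (−1)^{(a−1)N/a}`** for `ρ_G(g) : x ↦ g x`, `a` the order of
`g`, `N = |G|` (read in `ℤ`). [cite: BrunyateClark2014, §1.1 Thm. 1.4 (b) ("By a), ϵ_G(g) = (−1)^{(a−1)N/a}")] -/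
theorem sign_toPerm_self_eq [Fintype G] [DecidableEq G] (g : G) :
    ((Perm.sign (MulAction.toPerm g : Perm G) : ℤˣ) : ℤ) = (-1) ^ ((orderOf g - 1) * (Fintype.card G / orderOf g)) := by
  rw [sign_toPerm_eq_sign_mulRight, sign_mulRight_eq]

/-- **Theorem 1.4 (b), (i) ⟺ (ii)**: `ϵ_G(g) ≠ 1` iff the order `a` of `g` is even and `N/a` is odd.
[cite: BrunyateClark2014, §1.1 Thm. 1.4 (b) (i)⟺(ii)] -/
theorem sign_toPerm_self_ne_one_iff [Fintype G] [DecidableEq G] (g : G) :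
    Perm.sign (MulAction.toPerm g : Perm G) ≠ 1 ↔ Even (orderOf g) ∧ Odd (Fintype.card G / orderOf g) := by
  have h := sign_toPerm_self_eq g
  have hapos := orderOf_pos g
  constructor
  · intro hne
    have hodd : Odd ((orderOf g - 1) * (Fintype.card G / orderOf g)) := by
      by_contra hev
      rw [Nat.not_odd_iff_even] at hev
      rw [hev.neg_one_pow] at h
      exact hne (Units.val_eq_one.mp h)
    obtain ⟨⟨k, hk⟩, h2⟩ := Nat.odd_mul.mp hodd
    exact ⟨⟨k + 1, by omega⟩, h2⟩
  · rintro ⟨⟨k, hk⟩, h2⟩ h1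
    have hodd : Odd ((orderOf g - 1) * (Fintype.card G / orderOf g)) := Nat.odd_mul.mpr ⟨⟨k - 1, by omega⟩, h2⟩
    rw [h1, Units.val_one, hodd.neg_one_pow] at h
    norm_num at h

/-- **Theorem 1.4 (b), (i) ⟺ (iii) (Euler's criterion)**, for a group of even order `N`: `ϵ_G(g) ≠ 1 ⟺ g^{N/2} ≠ 1`
("the order of `g^{N/2}` = `a / gcd(a, N/2)`. Thus `g^{N/2} = 1` iff `gcd(a, N/2) = a` iff `a | N/2` iff `N/a` is even").
[cite: BrunyateClark2014, §1.1 Thm. 1.4 (b) (i)⟺(iii)] -/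
theorem sign_toPerm_self_ne_one_iff_pow_ne_one [Fintype G] [DecidableEq G] (hG : Even (Fintype.card G)) (g : G) :
    Perm.sign (MulAction.toPerm g : Perm G) ≠ 1 ↔ g ^ (Fintype.card G / 2) ≠ 1 := by
  rw [sign_toPerm_self_ne_one_iff, ne_eq, ← orderOf_dvd_iff_pow_eq_one]
  obtain ⟨M, hM⟩ := hG
  have hN : Fintype.card G = 2 * M := by omega
  have hdvd : orderOf g ∣ 2 * M := by rw [← hN]; exact orderOf_dvd_card
  rw [hN, Nat.mul_div_cancel_left _ two_pos]
  constructor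
  · -- `a ∣ M = N/2` ⟹ `N/a = 2 (M/a)` is even
    rintro ⟨-, hodd⟩ ⟨t, ht⟩
    rw [ht, show 2 * (orderOf g * t) = orderOf g * (2 * t) by ring, Nat.mul_div_cancel_left _ (orderOf_pos g)] at hodd
    exact Nat.not_even_iff_odd.mpr hodd (even_two_mul t)
  · intro hndvd
    refine ⟨?_, ?_⟩
    · -- an odd divisor of `2M` divides `M`
      by_contra hodd
      exact hndvd ((Nat.coprime_two_right.mpr (Nat.not_even_iff_odd.mp hodd)).dvd_mul_left.mp hdvd)
    · -- `N/a` even ⟹ `a ∣ M`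
      by_contra hev
      obtain ⟨t, ht⟩ := Nat.not_odd_iff_even.mp hev
      refine hndvd ⟨t, Nat.eq_of_mul_eq_mul_left two_pos ?_⟩
      calc 2 * M = orderOf g * (2 * M / orderOf g) := (Nat.mul_div_cancel' hdvd).symm
        _ = 2 * (orderOf g * t) := by rw [ht]; ring

/-! ### (c) Morton's criterion -/

/-- **Theorem 1.4 (c) (Morton)**: the Cayley signature `ϵ_G` is nontrivial — some `ϵ_G(g) ≠ 1` — iff the Sylow
`2`-subgroups of `G` are cyclic and nontrivial. ("`ϵ_G` is nontrivial iff there is `g ∈ G` such that `⟨g⟩` has even order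
and odd index. If so, [the `2`-part of] `⟨g⟩` is a cyclic, nontrivial 2-Sylow subgroup. Conversely, a generator `g` of a
nontrivial cyclic 2-Sylow subgroup has even order and odd index.") [cite: BrunyateClark2014, §1.1 Thm. 1.4 (c)] -/
theorem exists_sign_toPerm_ne_one_iff [Fintype G] [DecidableEq G] :
    (∃ g : G, Perm.sign (MulAction.toPerm g : Perm G) ≠ 1) ↔
      ∀ P : Sylow 2 G, IsCyclic (P : Subgroup G) ∧ (P : Subgroup G) ≠ ⊥ := by
  have hN : Nat.card G = Fintype.card G := Nat.card_eq_fintype_card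
  constructor
  · rintro ⟨g, hg⟩ P
    obtain ⟨heven, hodd⟩ := (sign_toPerm_self_ne_one_iff g).mp hg
    have ha0 : orderOf g ≠ 0 := (orderOf_pos g).ne'
    have h2N : 2 ∣ Nat.card G := by rw [hN]; exact (even_iff_two_dvd.mp heven).trans orderOf_dvd_card
    -- the odd part `m` of `a`: `y = g ^ m` has order `2^{v₂(a)} = 2^{v₂(N)}`, so `⟨y⟩` is a (cyclic) Sylow `2`-subgroup
    have hm0 : ordCompl[2] (orderOf g) ≠ 0 := (Nat.ordCompl_pos 2 ha0).ne'
    have hy : orderOf (g ^ ordCompl[2] (orderOf g)) = 2 ^ (orderOf g).factorization 2 := by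
      rw [orderOf_pow_of_dvd hm0 (Nat.ordCompl_dvd _ _)]
      exact Nat.div_eq_of_eq_mul_left (Nat.pos_of_ne_zero hm0) (Nat.ordProj_mul_ordCompl_eq_self _ _).symm
    have hndvd : ¬2 ∣ Fintype.card G / orderOf g := by
      rw [← even_iff_two_dvd]; exact Nat.not_even_iff_odd.mpr hodd
    have hfac : (Nat.card G).factorization 2 = (orderOf g).factorization 2 := by
      rw [hN, ← Nat.div_mul_cancel (orderOf_dvd_card : orderOf g ∣ Fintype.card G),
        Nat.factorization_mul hodd.pos.ne' ha0, Finsupp.add_apply, Nat.factorization_eq_zero_of_not_dvd hndvd, zero_add]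
    have hcard : Nat.card (zpowers (g ^ ordCompl[2] (orderOf g))) = 2 ^ (Nat.card G).factorization 2 := by
      rw [Nat.card_zpowers, hy, hfac]
    obtain ⟨Q, hQ⟩ : ∃ Q : Sylow 2 G, (Q : Subgroup G) = zpowers (g ^ ordCompl[2] (orderOf g)) :=
      ⟨Sylow.ofCard _ hcard, rfl⟩
    -- every Sylow `2`-subgroup is conjugate to `⟨y⟩`, hence cyclic; it is nontrivial as `2 ∣ N`
    obtain ⟨c, hc⟩ := MulAction.exists_smul_eq G Q P
    refine ⟨(Subgroup.isCyclic_iff_exists_zpowers_eq_top _).mpr ?_, P.ne_bot_of_dvd_card h2N⟩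
    rw [← hc, Sylow.coe_subgroup_smul, hQ, Subgroup.pointwise_smul_def, MonoidHom.map_zpowers]
    exact ⟨_, rfl⟩
  · intro h
    obtain ⟨P⟩ := (inferInstance : Nonempty (Sylow 2 G))
    obtain ⟨hcyc, hne⟩ := h P
    obtain ⟨g, hg⟩ := (Subgroup.isCyclic_iff_exists_zpowers_eq_top _).mp hcyc
    have hcardP : Nat.card (P : Subgroup G) = 2 ^ (Nat.card G).factorization 2 := P.card_eq_multiplicity
    have hk : (Nat.card G).factorization 2 ≠ 0 := by
      intro hk
      rw [hk, pow_zero, Subgroup.card_eq_one] at hcardP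
      exact hne hcardP
    have ha : orderOf g = 2 ^ (Nat.card G).factorization 2 := by
      rw [← Nat.card_zpowers, hg]; exact hcardP
    refine ⟨g, (sign_toPerm_self_ne_one_iff g).mpr ⟨?_, ?_⟩⟩
    · rw [ha]; exact Nat.even_pow.mpr ⟨even_two, hk⟩
    · rw [← hN, ha]
      exact Nat.odd_iff.mpr (Nat.two_dvd_ne_zero.mp (Nat.not_dvd_ordCompl Nat.prime_two Nat.card_pos.ne'))

/-! ### (d) The kernel of `ϵ_G` is the unique subgroup of index `2` -/

/-- An element of odd order lies in every subgroup of index `2` ("it is normal and `G/H` is a `2`-group").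
[cite: BrunyateClark2014, §1.1 Thm. 1.4 (d) (proof)] -/
theorem mem_of_index_eq_two_of_odd_orderOf {K : Subgroup G} (hK : K.index = 2) {x : G} (hx : Odd (orderOf x)) :
    x ∈ K := by
  haveI := Subgroup.normal_of_index_eq_two hK
  have h2 : x ^ 2 ∈ K := hK ▸ K.pow_index_mem x
  obtain ⟨k, hk⟩ := hx
  have hxe : x = (x ^ 2) ^ (k + 1) := by
    rw [← pow_mul, show 2 * (k + 1) = orderOf x + 1 by omega, pow_succ, pow_orderOf_eq_one, one_mul]
  rw [hxe]
  exact K.pow_mem h2 _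

/-- If the Cayley signature `ϵ_G = sign ∘ ρ_G : G → {±1}` is nontrivial, its kernel has index `2`.
[cite: BrunyateClark2014, §1.1 Thm. 1.4 (d) (proof: "`K = Ker ϵ` is an index 2 subgroup of `G`")] -/
theorem index_ker_sign_comp_toPermHom [Fintype G] [DecidableEq G]
    (hε : ∃ g : G, Perm.sign (MulAction.toPerm g : Perm G) ≠ 1) :
    ((Perm.sign).comp (MulAction.toPermHom G G)).ker.index = 2 := by
  obtain ⟨g, hg⟩ := hε
  have hg' : Perm.sign (MulAction.toPerm g : Perm G) = -1 := (Int.units_eq_one_or _).resolve_left hg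
  refine Subgroup.index_eq_two_iff_exists_notMem_and.mpr ⟨g, ?_, fun b => ?_⟩
  · rwa [MonoidHom.mem_ker, MonoidHom.comp_apply, MulAction.toPermHom_apply]
  · rcases Int.units_eq_one_or (Perm.sign (MulAction.toPerm b : Perm G)) with hb | hb
    · exact Or.inr (by rwa [MonoidHom.mem_ker, MonoidHom.comp_apply, MulAction.toPermHom_apply])
    · refine Or.inl ?_
      rw [MonoidHom.mem_ker, map_mul, MonoidHom.comp_apply, MonoidHom.comp_apply, MulAction.toPermHom_apply,
        MulAction.toPermHom_apply, hb, hg', neg_one_mul, neg_neg]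

/-- **Theorem 1.4 (d)**: if the Cayley signature `ϵ_G = sign ∘ ρ_G` is nontrivial, its kernel is the unique subgroup of
index `2` of `G`.  Printed proof: by (c) a Sylow `2`-subgroup `P` is cyclic, so (Cayley; here Mathlib's Burnside-transfer
form `IsCyclic.isComplement'`) `G = N ⋊ P` with `N ⊴ G` of odd order; an index-`2` subgroup `H` is normal with `G/H` of
order `2`, so `H ⊇ N`; and `G/N ≅ P` is cyclic, so there is exactly one index-`2` subgroup containing `N`.
[cite: BrunyateClark2014, §1.1 Thm. 1.4 (d)] -/
theorem eq_ker_sign_comp_toPermHom_of_index_eq_two [Fintype G] [DecidableEq G]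
    (hε : ∃ g : G, Perm.sign (MulAction.toPerm g : Perm G) ≠ 1) {K : Subgroup G} (hK : K.index = 2) :
    K = ((Perm.sign).comp (MulAction.toPermHom G G)).ker := by
  classical
  have hidx := index_ker_sign_comp_toPermHom hε
  obtain ⟨P⟩ := (inferInstance : Nonempty (Sylow 2 G))
  obtain ⟨hcyc, hne⟩ := (exists_sign_toPerm_ne_one_iff.mp hε) P
  -- `P ≠ 1`, so `2 ∣ N` and `2` is the least prime factor of `N = |G|`
  have hPcard : Nat.card (P : Subgroup G) = 2 ^ (Nat.card G).factorization 2 := P.card_eq_multiplicity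
  have hk : (Nat.card G).factorization 2 ≠ 0 := by
    intro hk
    rw [hk, pow_zero, Subgroup.card_eq_one] at hPcard
    exact hne hPcard
  have h2 : (Nat.card G).minFac = 2 :=
    (Nat.minFac_eq_two_iff _).mpr ((dvd_pow_self 2 hk).trans (hPcard ▸ (P : Subgroup G).card_subgroup_dvd_card))
  -- Cayley's normal `2`-complement `N`: `N ⊴ G`, `N P = G`, `N ∩ P = 1`
  haveI hcycP : IsCyclic P := hcyc
  obtain ⟨N, hNn, hNP⟩ : ∃ N : Subgroup G, N.Normal ∧ N.IsComplement' (P : Subgroup G) :=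
    ⟨_, MonoidHom.normal_ker _, IsCyclic.isComplement' h2 hcycP⟩
  -- `|N| = |G| / |P|` is odd, so every element of `N` has odd order and `N` lies in every subgroup of index `2`
  have hNodd : Odd (Nat.card N) := by
    have hc : Nat.card G / Nat.card (P : Subgroup G) = Nat.card N :=
      Nat.div_eq_of_eq_mul_left Nat.card_pos hNP.card_mul.symm
    rw [← hc, hPcard]
    exact Nat.odd_iff.mpr (Nat.two_dvd_ne_zero.mp (Nat.not_dvd_ordCompl Nat.prime_two Nat.card_pos.ne'))
  have hNle : ∀ K' : Subgroup G, K'.index = 2 → N ≤ K' := fun K' hK' n hn =>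
    mem_of_index_eq_two_of_odd_orderOf hK' (hNodd.of_dvd_nat (N.orderOf_dvd_natCard hn))
  -- `G/N ≅ P` is cyclic: a subgroup containing `N` is determined by its index
  haveI : IsCyclic (G ⧸ N) :=
    isCyclic_of_surjective hNP.symm.QuotientMulEquiv.symm hNP.symm.QuotientMulEquiv.symm.surjective
  exact Subgroup.eq_of_index_eq_of_isCyclic_quotient' N Subgroup.index_ne_zero_of_finite (hNle K hK) (hNle _ hidx)
    (hK.trans hidx.symm)

/-- **Theorem 1.4 (d)**, packaged: if `ϵ_G` is nontrivial, `G` has exactly one subgroup of index `2` (namely `Ker ϵ_G`).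
[cite: BrunyateClark2014, §1.1 Thm. 1.4 (d)] -/
theorem existsUnique_index_eq_two [Fintype G] [DecidableEq G]
    (hε : ∃ g : G, Perm.sign (MulAction.toPerm g : Perm G) ≠ 1) : ∃! K : Subgroup G, K.index = 2 :=
  ⟨_, index_ker_sign_comp_toPermHom hε, fun _ hK => eq_ker_sign_comp_toPermHom_of_index_eq_two hε hK⟩

/-! ### §2.2 Lemma 2.2: the additive form `ϵ(s_a) = (−1)^{(n−1)#r/n}` -/

/-- **Lemma 2.2 (a)**: for `a` in a finite additive group `A` (e.g. `(r, +)` of a finite ring) of additive order `n`, the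
translation `s_a : x ↦ x + a` has signature `(−1)^{(n−1)·#A/n}` (read in `ℤ`) — Theorem 1.4 (b) for the additive group.
[cite: BrunyateClark2014, §2.2 Lemma 2.2 (a)] -/
theorem sign_addRight_eq {A : Type*} [AddGroup A] [Fintype A] [DecidableEq A] (a : A) :
    ((Perm.sign (Equiv.addRight a) : ℤˣ) : ℤ) = (-1) ^ ((addOrderOf a - 1) * (Fintype.card A / addOrderOf a)) := by
  rw [sign_eq_sign_of_equiv (Equiv.addRight a) (Equiv.mulRight (Multiplicative.ofAdd a)) Multiplicative.ofAdd
      fun _ => rfl, sign_mulRight_eq, orderOf_ofAdd_eq_addOrderOf, Fintype.card_multiplicative]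

/-- **Lemma 2.2 (a)**, left form: the left translation `x ↦ a + x` (`ρ_A(a)` for the additive group `A`) has the same
signature `(−1)^{(n−1)·#A/n}`, `n` the additive order of `a` (read in `ℤ`).
[cite: BrunyateClark2014, §2.2 Lemma 2.2 (a) & §1.1 Thm. 1.4 (b)] -/
theorem sign_addLeft_toPerm_eq {A : Type*} [AddGroup A] [Fintype A] [DecidableEq A] (a : A) :
    ((Perm.sign (AddAction.toPerm a : Perm A) : ℤˣ) : ℤ) = (-1) ^ ((addOrderOf a - 1) * (Fintype.card A / addOrderOf a)) := by
  rw [sign_eq_sign_of_equiv (AddAction.toPerm a : Perm A) (MulAction.toPerm (Multiplicative.ofAdd a) : Perm (Multiplicative A))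
      Multiplicative.ofAdd fun _ => rfl, sign_toPerm_self_eq, orderOf_ofAdd_eq_addOrderOf, Fintype.card_multiplicative]

/-! ### §1.6 Lemma 1.6: the Cayley signature through a quotient map `q : G → G/H` -/

/-- For a Sylow `2`-subgroup `P` of `G` and a normal subgroup `H` of ODD order, the quotient map `q : G → G/H` restricted to
`P` is an isomorphism onto its image `PH/H`: "Since `#H` is odd and `P` is a `2`-group, `PH/H ≅ P/(P ∩ H) = P`."
[cite: BrunyateClark2014, §1.1 Lemma 1.6 (b) (proof)] -/
theorem bijective_subgroupMap_mk_sylow_of_odd_card [Finite G] (H : Subgroup G) [H.Normal] (hH : Odd (Nat.card H))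
    (P : Sylow 2 G) : Function.Bijective ((QuotientGroup.mk' H).subgroupMap (P : Subgroup G)) := by
  refine ⟨?_, (QuotientGroup.mk' H).subgroupMap_surjective _⟩
  -- the kernel is `H ∩ P` (inside `P`), trivial as `gcd(#H, #P) = gcd(odd, 2^k) = 1`
  have hcop : (Nat.card H).Coprime (Nat.card (P : Subgroup G)) := by
    rw [P.card_eq_multiplicity]
    exact (Nat.coprime_two_right.mpr hH).pow_right _
  rw [← MonoidHom.ker_eq_bot_iff, Subgroup.ker_subgroupMap, QuotientGroup.ker_mk', Subgroup.subgroupOf_eq_bot]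
  exact Subgroup.disjoint_of_coprime_natCard hcop

/-- **Lemma 1.6 (b), the Sylow transport**: if `H ⊴ G` has odd order, then ("`PH/H` is a `2`-Sylow subgroup of `G′ = G/H`" and
"`PH/H ≅ P`") the Sylow `2`-subgroups of `G` are cyclic and nontrivial iff those of `G/H` are — so by Theorem 1.4 (c)
"`ϵ_G` is nontrivial iff `ϵ_{G′}` is nontrivial". [cite: BrunyateClark2014, §1.1 Lemma 1.6 (b) (proof)] -/
theorem forall_sylow_isCyclic_and_ne_bot_iff_quotient [Finite G] (H : Subgroup G) [H.Normal] (hH : Odd (Nat.card H)) :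
    (∀ P : Sylow 2 G, IsCyclic (P : Subgroup G) ∧ (P : Subgroup G) ≠ ⊥) ↔
      ∀ Q : Sylow 2 (G ⧸ H), IsCyclic (Q : Subgroup (G ⧸ H)) ∧ (Q : Subgroup (G ⧸ H)) ≠ ⊥ := by
  have hf := QuotientGroup.mk'_surjective H
  have key : ∀ P : Sylow 2 G, (IsCyclic (P : Subgroup G) ∧ (P : Subgroup G) ≠ ⊥) ↔
      (IsCyclic ((P.mapSurjective hf : Sylow 2 (G ⧸ H)) : Subgroup (G ⧸ H)) ∧
        ((P.mapSurjective hf : Sylow 2 (G ⧸ H)) : Subgroup (G ⧸ H)) ≠ ⊥) := by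
    intro P
    -- `q|_P : P ≃ PH/H`
    let e : (P : Subgroup G) ≃* (P : Subgroup G).map (QuotientGroup.mk' H) :=
      MulEquiv.ofBijective _ (bijective_subgroupMap_mk_sylow_of_odd_card H hH P)
    rw [Ne, Ne, ← Subgroup.card_eq_one, ← Subgroup.card_eq_one, Sylow.coe_mapSurjective, Nat.card_congr e.toEquiv]
    exact ⟨fun h => ⟨by haveI := h.1; exact isCyclic_of_surjective e e.surjective, h.2⟩,
      fun h => ⟨by haveI := h.1; exact isCyclic_of_surjective e.symm e.symm.surjective, h.2⟩⟩
  constructor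
  · intro h Q
    obtain ⟨P, rfl⟩ := Sylow.mapSurjective_surjective hf 2 Q
    exact (key P).mp (h P)
  · intro h P
    exact (key P).mpr (h _)

/-- **LEMMA 1.6 (a)**: "Let `H` be a normal subgroup of `G`; put `G′ = G/H` and `q : G → G′`. a) If `ϵ_G` and `ϵ_{G′}` are both
trivial or both nontrivial, then (4) `ϵ_G = ϵ_{G′} ∘ q`." Proof as printed: if both are nontrivial, `Ker(ϵ_{G′} ∘ q)` is an
index-`2` subgroup of `G`, which by Theorem 1.4 (d) (`eq_ker_sign_comp_toPermHom_of_index_eq_two`) is `Ker ϵ_G`, "and two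
homomorphisms into `{±1}` are equal iff their kernels are equal". [cite: BrunyateClark2014, §1.1 Lemma 1.6 (a)] -/
theorem sign_toPerm_eq_sign_toPerm_quotient [Fintype G] [DecidableEq G] (H : Subgroup G) [H.Normal] [Fintype (G ⧸ H)]
    [DecidableEq (G ⧸ H)]
    (h : (∃ g : G, Perm.sign (MulAction.toPerm g : Perm G) ≠ 1) ↔
      ∃ x : G ⧸ H, Perm.sign (MulAction.toPerm x : Perm (G ⧸ H)) ≠ 1)
    (g : G) : Perm.sign (MulAction.toPerm g : Perm G) = Perm.sign (MulAction.toPerm (g : G ⧸ H) : Perm (G ⧸ H)) := by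
  by_cases hG : ∃ g : G, Perm.sign (MulAction.toPerm g : Perm G) ≠ 1
  · have hG' := h.mp hG
    -- `Ker (ϵ_{G′} ∘ q)` has index `2` in `G`, hence is `Ker ϵ_G`
    have hidx : (((Perm.sign).comp (MulAction.toPermHom (G ⧸ H) (G ⧸ H))).comp (QuotientGroup.mk' H)).ker.index = 2 := by
      rw [← MonoidHom.comap_ker, Subgroup.index_comap_of_surjective _ (QuotientGroup.mk'_surjective H)]
      exact index_ker_sign_comp_toPermHom hG'
    have hker := eq_ker_sign_comp_toPermHom_of_index_eq_two hG hidx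
    have hiff : Perm.sign (MulAction.toPerm (g : G ⧸ H) : Perm (G ⧸ H)) = 1 ↔
        Perm.sign (MulAction.toPerm g : Perm G) = 1 := by
      have hg := SetLike.ext_iff.mp hker g
      simpa only [MonoidHom.mem_ker, MonoidHom.comp_apply, MulAction.toPermHom_apply, QuotientGroup.mk'_apply] using hg
    rcases Int.units_eq_one_or (Perm.sign (MulAction.toPerm g : Perm G)) with h1 | h1 <;>
      rcases Int.units_eq_one_or (Perm.sign (MulAction.toPerm (g : G ⧸ H) : Perm (G ⧸ H))) with h2 | h2
    · rw [h1, h2]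
    · exact absurd (hiff.mpr h1) (by rw [h2]; decide)
    · exact absurd (hiff.mp h2) (by rw [h1]; decide)
    · rw [h1, h2]
  · have hG' : ¬∃ x : G ⧸ H, Perm.sign (MulAction.toPerm x : Perm (G ⧸ H)) ≠ 1 := fun h' => hG (h.mpr h')
    push Not at hG hG'
    rw [hG, hG']

/-- **LEMMA 1.6 (b)**: "If `H` has odd order, then (4) holds": for `H ⊴ G` of odd order and every `g ∈ G`,
`ϵ_G(g) = ϵ_{G/H}(gH)` — the Cayley signature factors through `q : G → G/H`. ("`ϵ_G` is nontrivial iff `ϵ_{G′}` is nontrivial,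
so part a) applies.") [cite: BrunyateClark2014, §1.1 Lemma 1.6 (b)] -/
theorem sign_toPerm_eq_sign_toPerm_quotient_of_odd_card [Fintype G] [DecidableEq G] (H : Subgroup G) [H.Normal]
    [Fintype (G ⧸ H)] [DecidableEq (G ⧸ H)] (hH : Odd (Nat.card H)) (g : G) :
    Perm.sign (MulAction.toPerm g : Perm G) = Perm.sign (MulAction.toPerm (g : G ⧸ H) : Perm (G ⧸ H)) :=
  sign_toPerm_eq_sign_toPerm_quotient H
    (by rw [exists_sign_toPerm_ne_one_iff, exists_sign_toPerm_ne_one_iff,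
      forall_sylow_isCyclic_and_ne_bot_iff_quotient H hH]) g

end Literature.GroupTheory
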